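import Summits.AtomisticToContinuum.HydrodynamicLimit.Theorems.InformationPercolationEngineSpectralContractionRCoreBoundMoments

/-!
# Core form bound for the crux `SpectralContractionR` (stmt-AtomisticToContinuum-13913), stub D of line `Sketch` (2/2)

Swap-symmetrisation: on `Ω = (ℝ³ × ℝ³) × S²` with the flux weight
`ρ(v, w, ω) = ((v-w)·ω)₊ M(v) M(w)` (`M = maxwellianBeta 1`) put `p₁ = g(v)`, `p₂ = g(w)`, `p₃ = g(v')`,
`p₄ = g(w')`, `(v', w') = collide ω (v, w)`. With `E[F] = ∫ ρ F dλ`: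
`E[p₁ p₃] = carlemanForm 1 g g = Q`, `E[p₁²] = N(g) = ∫ g² a₁ M`, `E[p₁ p₂] = W(g)` (flux pair correlation);
the exchange symmetry `(v, w, ω) ↦ (w, v, -ω)` gives `E[p₂ p₄] = E[p₁ p₃]`, `E[p₂ p₃] = E[p₁ p₄]`, `E[p₂²] = E[p₁²]`;
ISOTROPY (hypothesis, stub A of the line) gives `E[p₁ p₄] = E[p₁ p₃]`; the collision involution
`(v, w, ω) ↦ (w', v', ω)` preserves `ρ dλ` and maps `p₁ + p₂` to `p₃ + p₄`. Hence
`4 Q = E[(p₁+p₂)(p₃+p₄)]` and `|E[(p₁+p₂)(p₃+p₄)]| ≤ ½ E[(p₁+p₂)²] + ½ E[(p₃+p₄)²] = E[(p₁+p₂)²] = 2N + 2W`,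
i.e. `|Q| ≤ ½ (N + W)` — the registered stub `stub_coreBound`.
-/

noncomputable section

open MeasureTheory Metric Real Set Filter Topology
open scoped InnerProductSpace ENNReal

namespace Summit.AtomisticToContinuum.HydrodynamicLimit.Theorems.SpectralContractionRLine.CoreBound

open Literature.MathematicalPhysics.KineticTheory
open Literature.Analysis.FunctionSpaces (maxwellianBeta maxwellianBeta_one maxwellianBeta_pos)
open Literature.Analysis.FluidPDE (globalMaxwellian)
open TaggedSphereDiffusion (collisionFrequency)

/-! ## Real (Bochner) identities: Tonelli/Fubini readings of the weighted moments -/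

/-- Fubini on `Ω = (ℝ³ × ℝ³) × S²`: a triple Bochner integral of an integrable function as an iterated one. [folklore] -/
theorem integral_prod3 (F : ((V3 × V3) × (sphere (0 : V3) 1)) → ℝ) (hF : Integrable F (((volume : Measure V3).prod (volume : Measure V3)).prod (sphereMeasure : Measure (sphere (0 : V3) 1)))) :
    ∫ x, F x ∂(((volume : Measure V3).prod (volume : Measure V3)).prod (sphereMeasure : Measure (sphere (0 : V3) 1))) = ∫ v, ∫ w, ∫ ω, F ((v, w), ω) ∂sphereMeasure := by
  rw [integral_prod _ hF, integral_prod _ hF.integral_prod_left]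

/-- **`E[g(v) g(w)] = W(g)`**, the flux pair correlation. [folklore] -/
theorem integral_weight_mul_fst_mul_snd {g : V3 → ℝ}
    (hI : Integrable (fun x : ((V3 × V3) × (sphere (0 : V3) 1)) => hardSphereKernel x.1 x.2 * (maxwellianBeta 1 x.1.1 * maxwellianBeta 1 x.1.2) *
      (g x.1.1 * g x.1.2)) (((volume : Measure V3).prod (volume : Measure V3)).prod (sphereMeasure : Measure (sphere (0 : V3) 1)))) :
    ∫ x, hardSphereKernel x.1 x.2 * (maxwellianBeta 1 x.1.1 * maxwellianBeta 1 x.1.2) * (g x.1.1 * g x.1.2) ∂(((volume : Measure V3).prod (volume : Measure V3)).prod (sphereMeasure : Measure (sphere (0 : V3) 1))) =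
      ∫ v, ∫ w, (∫ ω, hardSphereKernel (v, w) ω ∂sphereMeasure) *
        ((maxwellianBeta 1 v * g v) * (maxwellianBeta 1 w * g w)) := by
  rw [integral_prod3 _ hI]
  refine integral_congr_ae (Eventually.of_forall fun v => ?_)
  refine integral_congr_ae (Eventually.of_forall fun w => ?_)
  simp only
  rw [integral_mul_const, integral_mul_const]
  ring

/-- **`E[g(v) g(v')] = Q(g, g)`**, the gain form (Carleman representation, a.e. in `v`). [folklore] -/
theorem integral_weight_mul_fst_mul_collide_fst {g : V3 → ℝ} (hg : FiniteEnergy 1 g)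
    (hI : Integrable (fun x : ((V3 × V3) × (sphere (0 : V3) 1)) => hardSphereKernel x.1 x.2 * (maxwellianBeta 1 x.1.1 * maxwellianBeta 1 x.1.2) *
      (g x.1.1 * g (collide x.2 x.1).1)) (((volume : Measure V3).prod (volume : Measure V3)).prod (sphereMeasure : Measure (sphere (0 : V3) 1)))) :
    ∫ x, hardSphereKernel x.1 x.2 * (maxwellianBeta 1 x.1.1 * maxwellianBeta 1 x.1.2) *
        (g x.1.1 * g (collide x.2 x.1).1) ∂(((volume : Measure V3).prod (volume : Measure V3)).prod (sphereMeasure : Measure (sphere (0 : V3) 1))) = carlemanForm 1 g g := by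
  rw [integral_prod3 _ hI, carlemanForm_eq_integral_carlemanGain (by simp) one_pos hg.measurable hg.integrable
    hg.measurable hg.integrable]
  have hcar : ∀ᵐ v : V3, linearBoltzmannGain 1 g v = carlemanGain 1 g v := by
    filter_upwards [ae_integrable_carlemanKernel_mul (by simp) one_pos hg.measurable hg.integrable] with v hv
    exact linearBoltzmannGain_eq_carlemanGain (by simp) one_pos hg.measurable v hv
  refine integral_congr_ae ?_
  filter_upwards [hcar] with v hv
  simp only
  rw [← hv, linearBoltzmannGain_eq]
  have hin : ∀ w : V3, ∫ ω, hardSphereKernel (v, w) ω * (maxwellianBeta 1 v * maxwellianBeta 1 w) *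
      (g v * g (collide ω (v, w)).1) ∂sphereMeasure = (g v * maxwellianBeta 1 v) *
        ∫ ω, gainIntegrand 1 g v w ω ∂sphereMeasure := by
    intro w
    rw [← integral_const_mul]
    refine integral_congr_ae (Eventually.of_forall fun ω => ?_)
    simp only [gainIntegrand]
    ring
  simp_rw [hin]
  rw [integral_const_mul]
  ring

/-- ISOTROPY in integrated form: for fixed `(v, w)`, `∫ ((v-w)·ω)₊ g(w') dσ = ∫ ((v-w)·ω)₊ g(v') dσ` once the
flux-weighted laws of `w'` and `v'` coincide. [folklore] -/
theorem integral_kernel_mul_collide_snd_eq {g : V3 → ℝ} (hg : Measurable g)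
    (hiso : ∀ v w : V3,
      (sphereMeasure.withDensity (fun ω => ENNReal.ofReal (hardSphereKernel (v, w) ω))).map
          (fun ω => (collide ω (v, w)).2) =
        (sphereMeasure.withDensity (fun ω => ENNReal.ofReal (hardSphereKernel (v, w) ω))).map
          (fun ω => (collide ω (v, w)).1))
    (v w : V3) :
    ∫ ω, hardSphereKernel (v, w) ω * g (collide ω (v, w)).2 ∂sphereMeasure =
      ∫ ω, hardSphereKernel (v, w) ω * g (collide ω (v, w)).1 ∂sphereMeasure := by
  have hBm : Measurable fun ω : sphere (0 : V3) 1 => ENNReal.ofReal (hardSphereKernel (v, w) ω) :=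
    (continuous_hardSphereKernel.comp (continuous_const.prodMk continuous_id)).measurable.ennreal_ofReal
  have hrepr : ∀ (φ : sphere (0 : V3) 1 → V3), Measurable φ →
      ∫ ω, hardSphereKernel (v, w) ω * g (φ ω) ∂sphereMeasure =
        ∫ y, g y ∂((sphereMeasure.withDensity (fun ω => ENNReal.ofReal (hardSphereKernel (v, w) ω))).map φ) := by
    intro φ hφ
    rw [integral_map hφ.aemeasurable hg.aestronglyMeasurable,
      integral_withDensity_eq_integral_toReal_smul hBm (Eventually.of_forall fun _ => ENNReal.ofReal_lt_top)]
    refine integral_congr_ae (Eventually.of_forall fun ω => ?_)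
    simp only [smul_eq_mul]
    rw [ENNReal.toReal_ofReal (hardSphereKernel_nonneg _ _)]
  have hm2 : Measurable fun ω : sphere (0 : V3) 1 => (collide ω (v, w)).2 :=
    (Literature.Analysis.FluidPDE.continuous_collide_uncurry.comp
      (continuous_const.prodMk continuous_id)).snd.measurable
  have hm1 : Measurable fun ω : sphere (0 : V3) 1 => (collide ω (v, w)).1 :=
    (Literature.Analysis.FluidPDE.continuous_collide_uncurry.comp
      (continuous_const.prodMk continuous_id)).fst.measurable
  rw [hrepr _ hm2, hrepr _ hm1, hiso v w]

/-- **`E[g(v) g(w')] = E[g(v) g(v')]`** under isotropy. [folklore] -/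
theorem integral_weight_mul_fst_mul_collide_snd {g : V3 → ℝ} (hg : Measurable g)
    (hiso : ∀ v w : V3,
      (sphereMeasure.withDensity (fun ω => ENNReal.ofReal (hardSphereKernel (v, w) ω))).map
          (fun ω => (collide ω (v, w)).2) =
        (sphereMeasure.withDensity (fun ω => ENNReal.ofReal (hardSphereKernel (v, w) ω))).map
          (fun ω => (collide ω (v, w)).1))
    (hI2 : Integrable (fun x : ((V3 × V3) × (sphere (0 : V3) 1)) => hardSphereKernel x.1 x.2 * (maxwellianBeta 1 x.1.1 * maxwellianBeta 1 x.1.2) *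
      (g x.1.1 * g (collide x.2 x.1).2)) (((volume : Measure V3).prod (volume : Measure V3)).prod (sphereMeasure : Measure (sphere (0 : V3) 1))))
    (hI1 : Integrable (fun x : ((V3 × V3) × (sphere (0 : V3) 1)) => hardSphereKernel x.1 x.2 * (maxwellianBeta 1 x.1.1 * maxwellianBeta 1 x.1.2) *
      (g x.1.1 * g (collide x.2 x.1).1)) (((volume : Measure V3).prod (volume : Measure V3)).prod (sphereMeasure : Measure (sphere (0 : V3) 1)))) :
    ∫ x, hardSphereKernel x.1 x.2 * (maxwellianBeta 1 x.1.1 * maxwellianBeta 1 x.1.2) *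
        (g x.1.1 * g (collide x.2 x.1).2) ∂(((volume : Measure V3).prod (volume : Measure V3)).prod (sphereMeasure : Measure (sphere (0 : V3) 1))) =
      ∫ x, hardSphereKernel x.1 x.2 * (maxwellianBeta 1 x.1.1 * maxwellianBeta 1 x.1.2) *
        (g x.1.1 * g (collide x.2 x.1).1) ∂(((volume : Measure V3).prod (volume : Measure V3)).prod (sphereMeasure : Measure (sphere (0 : V3) 1))) := by
  rw [integral_prod3 _ hI2, integral_prod3 _ hI1]
  refine integral_congr_ae (Eventually.of_forall fun v => ?_)
  refine integral_congr_ae (Eventually.of_forall fun w => ?_)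
  simp only
  have hfac : ∀ (φ : sphere (0 : V3) 1 → V3),
      ∫ ω, hardSphereKernel (v, w) ω * (maxwellianBeta 1 v * maxwellianBeta 1 w) * (g v * g (φ ω)) ∂sphereMeasure =
        (maxwellianBeta 1 v * maxwellianBeta 1 w * g v) *
          ∫ ω, hardSphereKernel (v, w) ω * g (φ ω) ∂sphereMeasure := by
    intro φ
    rw [← integral_const_mul]
    refine integral_congr_ae (Eventually.of_forall fun ω => ?_)
    ring
  rw [hfac (fun ω => (collide ω (v, w)).2), hfac (fun ω => (collide ω (v, w)).1),
    integral_kernel_mul_collide_snd_eq hg hiso v w]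

/-- **`E[g(w)²] = E[g(v)²]`** (exchange symmetry, Bochner form). [folklore] -/
theorem integral_weight_mul_snd_mul_snd (g : V3 → ℝ) :
    ∫ x, hardSphereKernel x.1 x.2 * (maxwellianBeta 1 x.1.1 * maxwellianBeta 1 x.1.2) * (g x.1.2 * g x.1.2) ∂(((volume : Measure V3).prod (volume : Measure V3)).prod (sphereMeasure : Measure (sphere (0 : V3) 1))) =
      ∫ x, hardSphereKernel x.1 x.2 * (maxwellianBeta 1 x.1.1 * maxwellianBeta 1 x.1.2) * (g x.1.1 * g x.1.1) ∂(((volume : Measure V3).prod (volume : Measure V3)).prod (sphereMeasure : Measure (sphere (0 : V3) 1))) := by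
  rw [← Literature.Analysis.FluidPDE.integral_comp_swap_negDir (fun x : ((V3 × V3) × (sphere (0 : V3) 1)) =>
    hardSphereKernel x.1 x.2 * (maxwellianBeta 1 x.1.1 * maxwellianBeta 1 x.1.2) * (g x.1.1 * g x.1.1))]
  refine integral_congr_ae (Eventually.of_forall fun x => ?_)
  simp only [Prod.fst_swap, Prod.snd_swap]
  rw [weight_swapNeg]

/-- **`E[g(w) g(w')] = E[g(v) g(v')]`** (exchange symmetry). [folklore] -/
theorem integral_weight_mul_snd_mul_collide_snd (g : V3 → ℝ) :
    ∫ x, hardSphereKernel x.1 x.2 * (maxwellianBeta 1 x.1.1 * maxwellianBeta 1 x.1.2) *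
        (g x.1.2 * g (collide x.2 x.1).2) ∂(((volume : Measure V3).prod (volume : Measure V3)).prod (sphereMeasure : Measure (sphere (0 : V3) 1))) =
      ∫ x, hardSphereKernel x.1 x.2 * (maxwellianBeta 1 x.1.1 * maxwellianBeta 1 x.1.2) *
        (g x.1.1 * g (collide x.2 x.1).1) ∂(((volume : Measure V3).prod (volume : Measure V3)).prod (sphereMeasure : Measure (sphere (0 : V3) 1))) := by
  rw [← Literature.Analysis.FluidPDE.integral_comp_swap_negDir (fun x : ((V3 × V3) × (sphere (0 : V3) 1)) =>
    hardSphereKernel x.1 x.2 * (maxwellianBeta 1 x.1.1 * maxwellianBeta 1 x.1.2) * (g x.1.1 * g (collide x.2 x.1).1))]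
  refine integral_congr_ae (Eventually.of_forall fun x => ?_)
  simp only [collide_swapNeg, Prod.fst_swap, Prod.snd_swap]
  rw [weight_swapNeg]

/-- **`E[g(w) g(v')] = E[g(v) g(w')]`** (exchange symmetry). [folklore] -/
theorem integral_weight_mul_snd_mul_collide_fst (g : V3 → ℝ) :
    ∫ x, hardSphereKernel x.1 x.2 * (maxwellianBeta 1 x.1.1 * maxwellianBeta 1 x.1.2) *
        (g x.1.2 * g (collide x.2 x.1).1) ∂(((volume : Measure V3).prod (volume : Measure V3)).prod (sphereMeasure : Measure (sphere (0 : V3) 1))) =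
      ∫ x, hardSphereKernel x.1 x.2 * (maxwellianBeta 1 x.1.1 * maxwellianBeta 1 x.1.2) *
        (g x.1.1 * g (collide x.2 x.1).2) ∂(((volume : Measure V3).prod (volume : Measure V3)).prod (sphereMeasure : Measure (sphere (0 : V3) 1))) := by
  rw [← Literature.Analysis.FluidPDE.integral_comp_swap_negDir (fun x : ((V3 × V3) × (sphere (0 : V3) 1)) =>
    hardSphereKernel x.1 x.2 * (maxwellianBeta 1 x.1.1 * maxwellianBeta 1 x.1.2) * (g x.1.1 * g (collide x.2 x.1).2))]
  refine integral_congr_ae (Eventually.of_forall fun x => ?_)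
  simp only [collide_swapNeg, Prod.fst_swap, Prod.snd_swap]
  rw [weight_swapNeg]

/-- **`E[(g(v') + g(w'))²] = E[(g(v) + g(w))²]`**: the flux measure is invariant under the collision
involution `(v, w, ω) ↦ (w', v', ω)`. [folklore] -/
theorem integral_weight_mul_sq_add_collide (g : V3 → ℝ) :
    ∫ x, hardSphereKernel x.1 x.2 * (maxwellianBeta 1 x.1.1 * maxwellianBeta 1 x.1.2) *
        ((g (collide x.2 x.1).1 + g (collide x.2 x.1).2) * (g (collide x.2 x.1).1 + g (collide x.2 x.1).2)) ∂(((volume : Measure V3).prod (volume : Measure V3)).prod (sphereMeasure : Measure (sphere (0 : V3) 1))) =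
      ∫ x, hardSphereKernel x.1 x.2 * (maxwellianBeta 1 x.1.1 * maxwellianBeta 1 x.1.2) *
        ((g x.1.1 + g x.1.2) * (g x.1.1 + g x.1.2)) ∂(((volume : Measure V3).prod (volume : Measure V3)).prod (sphereMeasure : Measure (sphere (0 : V3) 1))) := by
  rw [← Literature.Analysis.FluidPDE.integral_comp_collideSwap_prod (fun x : ((V3 × V3) × (sphere (0 : V3) 1)) =>
    hardSphereKernel x.1 x.2 * (maxwellianBeta 1 x.1.1 * maxwellianBeta 1 x.1.2) * ((g x.1.1 + g x.1.2) * (g x.1.1 + g x.1.2)))]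
  refine integral_congr_ae (Eventually.of_forall fun x => ?_)
  simp only [Prod.fst_swap, Prod.snd_swap]
  rw [weight_collideSwap, add_comm (g (collide x.2 x.1).2)]

/-! ## The registered stub -/

/-- **STUB D of line `Sketch` (core form bound by swap-symmetrisation).** Given isotropy of hard-sphere
scattering (the partner law equals the tagged law — stub A of the line, verbatim), for every `g` of finite
`a₁M`-energy: `|carlemanForm 1 g g| ≤ ½ (∫ g² a₁ M + W(g))`, `W(g) = ∫∫ ν(v-w) (Mg)(v) (Mg)(w)` the flux pair
correlation. Proof: with `h = g(v) + g(w)`, `h' = g(v') + g(w')` on the flux space,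
`E[h h'] = 4 Q` (two exchange symmetries + isotropy) and `|E[h h']| ≤ ½E[h²] + ½E[h'²] = E[h²] = 2N + 2W`
(collision involution). [folklore] -/
theorem stub_coreBound :
    (∀ v w : V3,
      (sphereMeasure.withDensity (fun ω => ENNReal.ofReal (hardSphereKernel (v, w) ω))).map
          (fun ω => (collide ω (v, w)).2) =
        (sphereMeasure.withDensity (fun ω => ENNReal.ofReal (hardSphereKernel (v, w) ω))).map
          (fun ω => (collide ω (v, w)).1)) →
    ∀ g : V3 → ℝ, FiniteEnergy 1 g →
      |carlemanForm 1 g g| ≤ (1 / 2) *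
        ((∫ v, g v ^ 2 * (collisionFrequency 1 v * maxwellianBeta 1 v)) +
          ∫ v, ∫ w, (∫ ω, hardSphereKernel (v, w) ω ∂sphereMeasure) *
            ((maxwellianBeta 1 v * g v) * (maxwellianBeta 1 w * g w))) := by
  intro hiso g hg
  -- the four observables and their measurability
  have m1 : Measurable fun x : ((V3 × V3) × (sphere (0 : V3) 1)) => g x.1.1 := hg.measurable.comp (measurable_fst.comp measurable_fst)
  have m2 : Measurable fun x : ((V3 × V3) × (sphere (0 : V3) 1)) => g x.1.2 := hg.measurable.comp (measurable_snd.comp measurable_fst)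
  have m3 : Measurable fun x : ((V3 × V3) × (sphere (0 : V3) 1)) => g (collide x.2 x.1).1 := hg.measurable.comp measurable_collide_fst
  have m4 : Measurable fun x : ((V3 × V3) × (sphere (0 : V3) 1)) => g (collide x.2 x.1).2 := hg.measurable.comp measurable_collide_snd
  -- finite weighted second moments (= the energy)
  have hE : ∫⁻ v, ENNReal.ofReal (g v ^ 2 * collisionFrequency 1 v * maxwellianBeta 1 v) < ∞ :=
    hg.integrable.lintegral_lt_top
  have f1 : ∫⁻ x, ENNReal.ofReal (hardSphereKernel x.1 x.2 * (maxwellianBeta 1 x.1.1 * maxwellianBeta 1 x.1.2) *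
      (fun x : ((V3 × V3) × (sphere (0 : V3) 1)) => g x.1.1) x ^ 2) ∂(((volume : Measure V3).prod (volume : Measure V3)).prod (sphereMeasure : Measure (sphere (0 : V3) 1))) < ∞ := by
    simp only; rw [lintegral_weight_mul_sq_fst hg.measurable]; exact hE
  have f2 : ∫⁻ x, ENNReal.ofReal (hardSphereKernel x.1 x.2 * (maxwellianBeta 1 x.1.1 * maxwellianBeta 1 x.1.2) *
      (fun x : ((V3 × V3) × (sphere (0 : V3) 1)) => g x.1.2) x ^ 2) ∂(((volume : Measure V3).prod (volume : Measure V3)).prod (sphereMeasure : Measure (sphere (0 : V3) 1))) < ∞ := by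
    simp only; rw [lintegral_weight_mul_sq_snd hg.measurable]; exact hE
  have f3 : ∫⁻ x, ENNReal.ofReal (hardSphereKernel x.1 x.2 * (maxwellianBeta 1 x.1.1 * maxwellianBeta 1 x.1.2) *
      (fun x : ((V3 × V3) × (sphere (0 : V3) 1)) => g (collide x.2 x.1).1) x ^ 2) ∂(((volume : Measure V3).prod (volume : Measure V3)).prod (sphereMeasure : Measure (sphere (0 : V3) 1))) < ∞ := by
    simp only; rw [lintegral_weight_mul_sq_collide_fst hg.measurable]; exact hE
  have f4 : ∫⁻ x, ENNReal.ofReal (hardSphereKernel x.1 x.2 * (maxwellianBeta 1 x.1.1 * maxwellianBeta 1 x.1.2) *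
      (fun x : ((V3 × V3) × (sphere (0 : V3) 1)) => g (collide x.2 x.1).2) x ^ 2) ∂(((volume : Measure V3).prod (volume : Measure V3)).prod (sphereMeasure : Measure (sphere (0 : V3) 1))) < ∞ := by
    simp only; rw [lintegral_weight_mul_sq_collide_snd hg.measurable]; exact hE
  -- integrability of the weighted pair products
  have i11 := integrable_weight_mul_mul weight_nonneg measurable_weight m1 m1 f1 f1
  have i12 := integrable_weight_mul_mul weight_nonneg measurable_weight m1 m2 f1 f2
  have i22 := integrable_weight_mul_mul weight_nonneg measurable_weight m2 m2 f2 f2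
  have i13 := integrable_weight_mul_mul weight_nonneg measurable_weight m1 m3 f1 f3
  have i14 := integrable_weight_mul_mul weight_nonneg measurable_weight m1 m4 f1 f4
  have i23 := integrable_weight_mul_mul weight_nonneg measurable_weight m2 m3 f2 f3
  have i24 := integrable_weight_mul_mul weight_nonneg measurable_weight m2 m4 f2 f4
  have i33 := integrable_weight_mul_mul weight_nonneg measurable_weight m3 m3 f3 f3
  have i34 := integrable_weight_mul_mul weight_nonneg measurable_weight m3 m4 f3 f4
  have i44 := integrable_weight_mul_mul weight_nonneg measurable_weight m4 m4 f4 f4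
  simp only at i11 i12 i22 i13 i14 i23 i24 i33 i34 i44
  -- the identities
  have e13 := integral_weight_mul_fst_mul_collide_fst hg i13
  have e14 := integral_weight_mul_fst_mul_collide_snd hg.measurable hiso i14 i13
  have e23 := integral_weight_mul_snd_mul_collide_fst g
  have e24 := integral_weight_mul_snd_mul_collide_snd g
  have e12 := integral_weight_mul_fst_mul_snd i12
  have e22 := integral_weight_mul_snd_mul_snd g
  have eT := integral_weight_mul_sq_add_collide g
  have e11 : ∫ x, hardSphereKernel x.1 x.2 * (maxwellianBeta 1 x.1.1 * maxwellianBeta 1 x.1.2) *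
      (g x.1.1 * g x.1.1) ∂(((volume : Measure V3).prod (volume : Measure V3)).prod (sphereMeasure : Measure (sphere (0 : V3) 1))) = ∫ v, g v ^ 2 * (collisionFrequency 1 v * maxwellianBeta 1 v) := by
    have hmR : AEStronglyMeasurable (fun v : V3 => g v ^ 2 * (collisionFrequency 1 v * maxwellianBeta 1 v)) volume :=
      ((hg.measurable.pow_const 2).mul ((continuous_collisionFrequency one_pos).measurable.mul
        (continuous_maxwellianBeta 1).measurable)).aestronglyMeasurable
    rw [integral_eq_lintegral_of_nonneg_ae (Eventually.of_forall fun x => mul_nonneg (weight_nonneg x)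
        (mul_self_nonneg _)) i11.aestronglyMeasurable,
      integral_eq_lintegral_of_nonneg_ae (Eventually.of_forall fun v => mul_nonneg (sq_nonneg _)
        (mul_nonneg (TaggedLinearBoltzmannSeries.collisionFrequency_nonneg one_pos v) (maxwellianBeta_pos one_pos v).le))
        hmR]
    congr 1
    calc ∫⁻ x, ENNReal.ofReal (hardSphereKernel x.1 x.2 * (maxwellianBeta 1 x.1.1 * maxwellianBeta 1 x.1.2) *
          (g x.1.1 * g x.1.1)) ∂(((volume : Measure V3).prod (volume : Measure V3)).prod (sphereMeasure : Measure (sphere (0 : V3) 1)))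
        = ∫⁻ x, ENNReal.ofReal (hardSphereKernel x.1 x.2 * (maxwellianBeta 1 x.1.1 * maxwellianBeta 1 x.1.2) *
          g x.1.1 ^ 2) ∂(((volume : Measure V3).prod (volume : Measure V3)).prod (sphereMeasure : Measure (sphere (0 : V3) 1))) := lintegral_congr fun x => by rw [sq]
      _ = ∫⁻ v, ENNReal.ofReal (g v ^ 2 * collisionFrequency 1 v * maxwellianBeta 1 v) :=
          lintegral_weight_mul_sq_fst hg.measurable
      _ = ∫⁻ v, ENNReal.ofReal (g v ^ 2 * (collisionFrequency 1 v * maxwellianBeta 1 v)) :=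
          lintegral_congr fun v => by rw [mul_assoc]
  -- Step 1: `E[h h'] = 4 Q`
  have hcross : ∫ x, hardSphereKernel x.1 x.2 * (maxwellianBeta 1 x.1.1 * maxwellianBeta 1 x.1.2) *
      ((g x.1.1 + g x.1.2) * (g (collide x.2 x.1).1 + g (collide x.2 x.1).2)) ∂(((volume : Measure V3).prod (volume : Measure V3)).prod (sphereMeasure : Measure (sphere (0 : V3) 1))) = 4 * carlemanForm 1 g g := by
    have hsplit : (fun x : ((V3 × V3) × (sphere (0 : V3) 1)) => hardSphereKernel x.1 x.2 * (maxwellianBeta 1 x.1.1 * maxwellianBeta 1 x.1.2) *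
        ((g x.1.1 + g x.1.2) * (g (collide x.2 x.1).1 + g (collide x.2 x.1).2))) = fun x =>
        (hardSphereKernel x.1 x.2 * (maxwellianBeta 1 x.1.1 * maxwellianBeta 1 x.1.2) * (g x.1.1 * g (collide x.2 x.1).1) +
          hardSphereKernel x.1 x.2 * (maxwellianBeta 1 x.1.1 * maxwellianBeta 1 x.1.2) * (g x.1.1 * g (collide x.2 x.1).2)) +
        (hardSphereKernel x.1 x.2 * (maxwellianBeta 1 x.1.1 * maxwellianBeta 1 x.1.2) * (g x.1.2 * g (collide x.2 x.1).1) +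
          hardSphereKernel x.1 x.2 * (maxwellianBeta 1 x.1.1 * maxwellianBeta 1 x.1.2) * (g x.1.2 * g (collide x.2 x.1).2)) := by
      funext x; ring
    rw [hsplit, integral_add, integral_add i13 i14, integral_add i23 i24, e23, e14, e24, e13]
    · ring
    · exact i13.add i14
    · exact i23.add i24
  -- Step 2: `E[h²] = 2N + 2W`
  have hsq : ∫ x, hardSphereKernel x.1 x.2 * (maxwellianBeta 1 x.1.1 * maxwellianBeta 1 x.1.2) *
      ((g x.1.1 + g x.1.2) * (g x.1.1 + g x.1.2)) ∂(((volume : Measure V3).prod (volume : Measure V3)).prod (sphereMeasure : Measure (sphere (0 : V3) 1))) =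
      2 * (∫ v, g v ^ 2 * (collisionFrequency 1 v * maxwellianBeta 1 v)) +
        2 * ∫ v, ∫ w, (∫ ω, hardSphereKernel (v, w) ω ∂sphereMeasure) *
          ((maxwellianBeta 1 v * g v) * (maxwellianBeta 1 w * g w)) := by
    have hsplit : (fun x : ((V3 × V3) × (sphere (0 : V3) 1)) => hardSphereKernel x.1 x.2 * (maxwellianBeta 1 x.1.1 * maxwellianBeta 1 x.1.2) *
        ((g x.1.1 + g x.1.2) * (g x.1.1 + g x.1.2))) = fun x =>
        (hardSphereKernel x.1 x.2 * (maxwellianBeta 1 x.1.1 * maxwellianBeta 1 x.1.2) * (g x.1.1 * g x.1.1) +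
          hardSphereKernel x.1 x.2 * (maxwellianBeta 1 x.1.1 * maxwellianBeta 1 x.1.2) * (g x.1.1 * g x.1.2)) +
        (hardSphereKernel x.1 x.2 * (maxwellianBeta 1 x.1.1 * maxwellianBeta 1 x.1.2) * (g x.1.1 * g x.1.2) +
          hardSphereKernel x.1 x.2 * (maxwellianBeta 1 x.1.1 * maxwellianBeta 1 x.1.2) * (g x.1.2 * g x.1.2)) := by
      funext x; ring
    rw [hsplit, integral_add, integral_add i11 i12, integral_add i12 i22, e22, e11, e12]
    · ring
    · exact i11.add i12
    · exact i12.add i22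
  -- Step 3: `|E[h h']| ≤ ½ E[h²] + ½ E[h'²] = E[h²]`
  have hint1 : Integrable (fun x : ((V3 × V3) × (sphere (0 : V3) 1)) => hardSphereKernel x.1 x.2 * (maxwellianBeta 1 x.1.1 * maxwellianBeta 1 x.1.2) *
      ((g x.1.1 + g x.1.2) * (g x.1.1 + g x.1.2))) (((volume : Measure V3).prod (volume : Measure V3)).prod (sphereMeasure : Measure (sphere (0 : V3) 1))) := by
    have hsplit : (fun x : ((V3 × V3) × (sphere (0 : V3) 1)) => hardSphereKernel x.1 x.2 * (maxwellianBeta 1 x.1.1 * maxwellianBeta 1 x.1.2) *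
        ((g x.1.1 + g x.1.2) * (g x.1.1 + g x.1.2))) = fun x =>
        (hardSphereKernel x.1 x.2 * (maxwellianBeta 1 x.1.1 * maxwellianBeta 1 x.1.2) * (g x.1.1 * g x.1.1) +
          hardSphereKernel x.1 x.2 * (maxwellianBeta 1 x.1.1 * maxwellianBeta 1 x.1.2) * (g x.1.1 * g x.1.2)) +
        (hardSphereKernel x.1 x.2 * (maxwellianBeta 1 x.1.1 * maxwellianBeta 1 x.1.2) * (g x.1.1 * g x.1.2) +
          hardSphereKernel x.1 x.2 * (maxwellianBeta 1 x.1.1 * maxwellianBeta 1 x.1.2) * (g x.1.2 * g x.1.2)) := by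
      funext x; ring
    rw [hsplit]; exact (i11.add i12).add (i12.add i22)
  have hint2 : Integrable (fun x : ((V3 × V3) × (sphere (0 : V3) 1)) => hardSphereKernel x.1 x.2 * (maxwellianBeta 1 x.1.1 * maxwellianBeta 1 x.1.2) *
      ((g (collide x.2 x.1).1 + g (collide x.2 x.1).2) * (g (collide x.2 x.1).1 + g (collide x.2 x.1).2))) (((volume : Measure V3).prod (volume : Measure V3)).prod (sphereMeasure : Measure (sphere (0 : V3) 1))) := by
    have hsplit : (fun x : ((V3 × V3) × (sphere (0 : V3) 1)) => hardSphereKernel x.1 x.2 * (maxwellianBeta 1 x.1.1 * maxwellianBeta 1 x.1.2) *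
        ((g (collide x.2 x.1).1 + g (collide x.2 x.1).2) * (g (collide x.2 x.1).1 + g (collide x.2 x.1).2))) = fun x =>
        (hardSphereKernel x.1 x.2 * (maxwellianBeta 1 x.1.1 * maxwellianBeta 1 x.1.2) *
            (g (collide x.2 x.1).1 * g (collide x.2 x.1).1) +
          hardSphereKernel x.1 x.2 * (maxwellianBeta 1 x.1.1 * maxwellianBeta 1 x.1.2) *
            (g (collide x.2 x.1).1 * g (collide x.2 x.1).2)) +
        (hardSphereKernel x.1 x.2 * (maxwellianBeta 1 x.1.1 * maxwellianBeta 1 x.1.2) *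
            (g (collide x.2 x.1).1 * g (collide x.2 x.1).2) +
          hardSphereKernel x.1 x.2 * (maxwellianBeta 1 x.1.1 * maxwellianBeta 1 x.1.2) *
            (g (collide x.2 x.1).2 * g (collide x.2 x.1).2)) := by
      funext x; ring
    rw [hsplit]; exact (i33.add i34).add (i34.add i44)
  have hbound : |∫ x, hardSphereKernel x.1 x.2 * (maxwellianBeta 1 x.1.1 * maxwellianBeta 1 x.1.2) *
      ((g x.1.1 + g x.1.2) * (g (collide x.2 x.1).1 + g (collide x.2 x.1).2)) ∂(((volume : Measure V3).prod (volume : Measure V3)).prod (sphereMeasure : Measure (sphere (0 : V3) 1)))| ≤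
      ∫ x, hardSphereKernel x.1 x.2 * (maxwellianBeta 1 x.1.1 * maxwellianBeta 1 x.1.2) *
        ((g x.1.1 + g x.1.2) * (g x.1.1 + g x.1.2)) ∂(((volume : Measure V3).prod (volume : Measure V3)).prod (sphereMeasure : Measure (sphere (0 : V3) 1))) := by
    calc |∫ x, hardSphereKernel x.1 x.2 * (maxwellianBeta 1 x.1.1 * maxwellianBeta 1 x.1.2) *
          ((g x.1.1 + g x.1.2) * (g (collide x.2 x.1).1 + g (collide x.2 x.1).2)) ∂(((volume : Measure V3).prod (volume : Measure V3)).prod (sphereMeasure : Measure (sphere (0 : V3) 1)))|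
        ≤ ∫ x, (1 / 2 : ℝ) * (hardSphereKernel x.1 x.2 * (maxwellianBeta 1 x.1.1 * maxwellianBeta 1 x.1.2) *
            ((g x.1.1 + g x.1.2) * (g x.1.1 + g x.1.2)) +
          hardSphereKernel x.1 x.2 * (maxwellianBeta 1 x.1.1 * maxwellianBeta 1 x.1.2) *
            ((g (collide x.2 x.1).1 + g (collide x.2 x.1).2) * (g (collide x.2 x.1).1 + g (collide x.2 x.1).2))) ∂(((volume : Measure V3).prod (volume : Measure V3)).prod (sphereMeasure : Measure (sphere (0 : V3) 1))) := by
          rw [← Real.norm_eq_abs]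
          refine norm_integral_le_of_norm_le ((hint1.add hint2).const_mul (1 / 2)) (Eventually.of_forall fun x => ?_)
          rw [Real.norm_eq_abs, abs_mul, abs_of_nonneg (weight_nonneg x)]
          have hx := weight_nonneg x
          have h2 : |(g x.1.1 + g x.1.2) * (g (collide x.2 x.1).1 + g (collide x.2 x.1).2)| * 2 ≤
              (g x.1.1 + g x.1.2) * (g x.1.1 + g x.1.2) +
                (g (collide x.2 x.1).1 + g (collide x.2 x.1).2) * (g (collide x.2 x.1).1 + g (collide x.2 x.1).2) := by
            rw [abs_mul]
            nlinarith [sq_nonneg (|g x.1.1 + g x.1.2| - |g (collide x.2 x.1).1 + g (collide x.2 x.1).2|),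
              sq_abs (g x.1.1 + g x.1.2), sq_abs (g (collide x.2 x.1).1 + g (collide x.2 x.1).2)]
          nlinarith [mul_le_mul_of_nonneg_left h2 hx]
      _ = (1 / 2 : ℝ) * ((∫ x, hardSphereKernel x.1 x.2 * (maxwellianBeta 1 x.1.1 * maxwellianBeta 1 x.1.2) *
            ((g x.1.1 + g x.1.2) * (g x.1.1 + g x.1.2)) ∂(((volume : Measure V3).prod (volume : Measure V3)).prod (sphereMeasure : Measure (sphere (0 : V3) 1)))) +
          ∫ x, hardSphereKernel x.1 x.2 * (maxwellianBeta 1 x.1.1 * maxwellianBeta 1 x.1.2) *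
            ((g (collide x.2 x.1).1 + g (collide x.2 x.1).2) * (g (collide x.2 x.1).1 + g (collide x.2 x.1).2)) ∂(((volume : Measure V3).prod (volume : Measure V3)).prod (sphereMeasure : Measure (sphere (0 : V3) 1)))) := by
          rw [integral_const_mul, integral_add hint1 hint2]
      _ = _ := by rw [eT]; ring
  -- Step 4: conclude
  rw [hcross, hsq, abs_mul, abs_of_pos (by norm_num : (0 : ℝ) < 4)] at hbound
  linarith

end Summit.AtomisticToContinuum.HydrodynamicLimit.Theorems.SpectralContractionRLine.CoreBound

end
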